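/- Copyright: the b2b-balaban cell (near-miss cell 7), T⁴-continuum fan-out, lineage t4-ne7b-p1 (node U5c COUNT
member).  Released under the licence of the surrounding project. -/
import Summits.QuantumFields.BalabanUV.T4Continuum.Support.HistoryGenealogyPedigree

/-!
# THE PEDIGREE OF A COMPONENT HISTORY, part 3 (junction M4, brick 2b — abstract half): the root step of a component's
`PGen` is print's extraction's, and OLDEST LINE FIRST (`HeadOldest`) holds for every name once the chosen order is
headed by an oldest old part (owner module of row NE7b, lineage `t4-ne7b-p1` gen 41; re-open object (α), `SCOPE-alpha.md`
v2.2 §5 row M4, D-M4-2∕-3 — PRE-POSITIONING ONLY)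

Summits-side support leaf of the T⁴-continuum cell (rung (B)+1 on a FINITE torus only; NOT infinite volume, NOT the
mass gap, NOT the Clay statement; NOT a proof of the spine estimate NE7b, which is the cell's OWN estimate, NOT PRINTED
and NOT PROVED).  [folklore] finite combinatorics over part 1 (`pedOf`, `OrderOK`, the `toPGen` unfoldings), row S13-R
(`pgenR`, `assembleR`, `joinTail`, `wrapR`) and the END's pedigree layer (`partsGen`, `partGen`, `rootStep_partGen`,
`rootStep_toPGen`, `HeadOldest`); PROCESS-AGNOSTIC and GEOMETRY-FREE (the oldest-first contact order itself is
CONSTRUCTED from the touch clause in brick 2c; here its defining property is a displayed hypothesis `HeadOK`); nothing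
printed is asserted, no `def … : Prop` fact of Bałaban's, zero `sorry`.  B16 = [Balaban1989LargeFieldII] pp. 385–387
under audit; locators only.

WHY.  The END's third encoding field `headOldest` (`HistoryGenTimed.Pedigree.HeadOldest`: the first part's line is born
no later than every other part's, and a component with several parts is headed by an OLD part — so that the tree
count's canonical form dates every merger strictly after the head's birth, `chronoC_genT`) constrains the ORDER of the
part lists and EXCLUDES one configuration: a component of several constituents none of which is old (a FRESH TOUCHING
CLUSTER — located open point G-M4-1, R-OWNER-41-4: print p. 385 «Take a component Z of the region Z_1. It is
determined by some of the large field regions Z^{(i)}_1 …» treats it as ONE region with the combined class; the END's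
birth clause would need a touch-connected domain, pass T).  THIS FILE: (§1) the root step of a left-nested `chainJoin`,
of a right-nested `joinTail`, of `assembleR` and of `joinP` is characterised as a minimum (`… ≤ k ↔ ∃ member ≤ k`);
(§2) hence **the root step of `toPGen cell (j, c)` EQUALS that of print's extraction `pgenR rnw j c`** for every
component and every admissible order (both are the minimum of the constituents' — the order and the nesting are
immaterial); (§3) the displayed order property `HeadOK` (level-`0` components have one constituent; a component of
≥ 2 constituents is headed by an OLD part of minimal extraction root step among its parts) and **`headOldest_pedOf`**.

HONEST.  Proves nothing of Bałaban's; `HeadOK` is DISCHARGED in brick 2c from the touch clause for histories without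
fresh clusters (and is unsatisfiable for a fresh cluster — G-M4-1 displayed, not hidden); NE7b NOT proved; spine 0∕9.
HONEST DEPENDENCY (cell): continuum YM on T⁴ ⇐ BetaPertH ∧ nine spine estimates (0/9 proved); BetaPertH ⇐ (D1) ∧ (D4) ∧
CAP+tail; G-an2-4 gates asym, D1 and NE2/3/4.  This file changes none of it. -/

open Finset
open Literature.MathematicalPhysics.QuantumFieldTheory.Balaban1983to89
open T4PersistenceDictionary
open Summit.QuantumFields.BalabanUV.T4Continuum.HistoryAdmissible
open Summit.QuantumFields.BalabanUV.T4Continuum.HistoryGen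
open Summit.QuantumFields.BalabanUV.T4Continuum.HistoryGenealogyExtraction

namespace Summit.QuantumFields.BalabanUV.T4Continuum.HistoryGenealogyPedigree

/-! ## §1 Root steps of join chains are minima -/

section Minima

variable {ε : Type*}

/-- root step of a right-nested join chain: `≤ k` iff some member's is [folklore] -/
theorem rootStep_joinTail_le_iff (k s : ℕ) :
    ∀ (T : PGen ε) (L : List (PGen ε)), (joinTail T L s).rootStep ≤ k ↔ ∃ U ∈ T :: L, U.rootStep ≤ k
  | T, [] => by simp
  | T, U :: L => by
      rw [joinTail_cons, PGen.rootStep, min_le_iff, rootStep_joinTail_le_iff k s U L]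
      constructor
      · rintro (h | ⟨V, hV, hVk⟩)
        · exact ⟨T, List.mem_cons_self, h⟩
        · exact ⟨V, List.mem_cons_of_mem _ hV, hVk⟩
      · rintro ⟨V, hV, hVk⟩
        rcases List.mem_cons.1 hV with rfl | hV
        · exact Or.inl hVk
        · exact Or.inr ⟨V, hV, hVk⟩

/-- root step of a left-nested join chain: `≤ k` iff some member's is [folklore] -/
theorem rootStep_chainJoin_le_iff (k s : ℕ) :
    ∀ (A : PGen ε) (Bs : List (PGen ε)), (chainJoin A Bs s).rootStep ≤ k ↔ ∃ U ∈ A :: Bs, U.rootStep ≤ k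
  | A, [] => by simp [chainJoin]
  | A, B :: Bs => by
      rw [chainJoin, rootStep_chainJoin_le_iff k s (PGen.join A B s) Bs]
      constructor
      · rintro ⟨V, hV, hVk⟩
        rcases List.mem_cons.1 hV with rfl | hV
        · rw [PGen.rootStep, min_le_iff] at hVk
          rcases hVk with h | h
          · exact ⟨A, List.mem_cons_self, h⟩
          · exact ⟨B, List.mem_cons_of_mem _ List.mem_cons_self, h⟩
        · exact ⟨V, List.mem_cons_of_mem _ (List.mem_cons_of_mem _ hV), hVk⟩
      · rintro ⟨V, hV, hVk⟩
        rcases List.mem_cons.1 hV with rfl | hV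
        · exact ⟨PGen.join V B s, List.mem_cons_self, by rw [PGen.rootStep]; exact min_le_of_left_le hVk⟩
        rcases List.mem_cons.1 hV with rfl | hV
        · exact ⟨PGen.join A V s, List.mem_cons_self, by rw [PGen.rootStep]; exact min_le_of_right_le hVk⟩
        · exact ⟨V, List.mem_cons_of_mem _ hV, hVk⟩

/-- root step of `assembleR` on a nonempty list: `≤ k` iff some constituent's is [folklore] -/
theorem rootStep_assembleR_le_iff (c : ε) (k s : ℕ) :
    ∀ L : List (PGen ε), L ≠ [] → ((assembleR c s L).rootStep ≤ k ↔ ∃ U ∈ L, U.rootStep ≤ k)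
  | [], h => (h rfl).elim
  | [T], _ => by simp
  | T :: U :: L, _ => by rw [assembleR_cons_cons]; exact rootStep_joinTail_le_iff k s T (U :: L)

/-- root step of `joinP` on a nonempty list: `≤ k` iff some constituent's is [folklore] -/
theorem rootStep_joinP_le_iff {α π : Type*} [Inhabited ε] (P : Pedigree α π) (c : α) (k : ℕ) :
    ∀ L : List (PGen ε), L ≠ [] → ((P.joinP c L).rootStep ≤ k ↔ ∃ U ∈ L, U.rootStep ≤ k)
  | [], h => (h rfl).elim
  | A :: As, _ => rootStep_chainJoin_le_iff k (P.step c) A As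

/-- two naturals with the same upper sets are equal [folklore] -/
theorem eq_of_forall_le_iff {a b : ℕ} (h : ∀ k, a ≤ k ↔ b ≤ k) : a = b :=
  le_antisymm ((h b).2 le_rfl) ((h a).1 le_rfl)

end Minima

/-! ## §2 The root step of a component's `PGen` is print's extraction's -/

section RootStep

variable {γ δ : Type*} [DecidableEq γ] [Inhabited δ] {H : ComponentHistory γ} {rnw : ℕ → γ → Bool}
  {ord : ℕ → γ → List (γ ⊕ γ)} (cell : γ → δ)

/-- under an admissible order and `WF`, the chosen order of a component is nonempty [folklore] -/
theorem ord_ne_nil (hW : H.WF) (hO : OrderOK H ord) {j : ℕ} {c : γ} (hc : c ∈ H.comp j) : ord j c ≠ [] := by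
  intro h0
  have := (hO j c hc).length_eq
  rw [h0] at this
  exact hW.nonempty j c hc (List.eq_nil_of_length_eq_zero (by simpa using this.symm))

/-- at level `0` the chosen order has no old entry (under `WF`) [folklore] -/
theorem lefts_ord_zero (hW : H.WF) (hO : OrderOK H ord) {c : γ} (hc : c ∈ H.comp 0) : lefts (ord 0 c) = [] := by
  have hp := hW.parts_zero c
  unfold ComponentHistory.parts at hp
  refine lefts_eq_nil_of_forall_isRight fun x hx => ?_
  cases x with
  | inr n => rfl
  | inl p => exact absurd ((mem_lefts_iff p _).2 ((hO 0 c hc).mem_iff.1 hx)) (by rw [hp]; simp)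

/-- at level `0` the chosen order's new entries are a nonempty list (under `WF`) [folklore] -/
theorem rights_ord_zero_ne_nil (hW : H.WF) (hO : OrderOK H ord) {c : γ} (hc : c ∈ H.comp 0) : rights (ord 0 c) ≠ [] := by
  intro h0
  have hlen := length_lefts_add_length_rights (ord 0 c)
  rw [lefts_ord_zero hW hO hc, h0] at hlen
  exact ord_ne_nil hW hO hc (List.eq_nil_of_length_eq_zero (by simpa using hlen.symm))

/-- **THE ROOT STEP OF `toPGen cell (j, c)` IS THE ROOT STEP OF `pgenR rnw j c`** for every component `c ∈ comp j` and
every admissible order: both are the minimum of the constituents' root steps (renewal does not move a root step; new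
regions have root step `j`), by induction on the level. [folklore] -/
theorem rootStep_toPGen_eq_pgenR (hW : H.WF) (hO : OrderOK H ord) :
    ∀ (j : ℕ) (c : γ), c ∈ H.comp j →
      ((pedOf H rnw ord).toPGen cell (j, c)).rootStep = (H.pgenR rnw j c).rootStep := by
  intro j
  induction j with
  | zero =>
      intro c hc
      -- both sides are `0`: nonempty lists of births at level `0`
      have hl : ((pedOf H rnw ord).toPGen cell (0, c)).rootStep ≤ 0 := by
        rw [toPGen_zero H rnw ord cell hc,
          rootStep_joinP_le_iff _ _ 0 _ (by simpa using rights_ord_zero_ne_nil hW hO hc)]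
        obtain ⟨n, ns, hns⟩ := List.exists_cons_of_ne_nil (rights_ord_zero_ne_nil hW hO hc)
        exact ⟨PGen.birth 0 (H.cls n) (cell n), by rw [hns]; simp, le_rfl⟩
      have hr := H.rootStep_pgenR_le rnw 0 c
      omega
  | succ j ih =>
      intro c hc
      have hne := ord_ne_nil hW hO hc
      refine eq_of_forall_le_iff fun k => ?_
      rw [toPGen_succ H rnw ord cell hc, rootStep_joinP_le_iff _ _ k _ (by simpa using hne),
        ComponentHistory.pgenR_succ_eq,
        rootStep_assembleR_le_iff c k (j + 1) _ (H.constituentsR_ne_nil rnw hW _ hc)]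
      -- constituent by constituent the root steps agree; the two lists are permutations of each other
      have key : ∀ q ∈ H.constit (j + 1) c,
          (Sum.elim (fun p => if rnw j p = true then PGen.renew ((pedOf H rnw ord).toPGen cell (j, p)) j
              else (pedOf H rnw ord).toPGen cell (j, p)) (fun n => PGen.birth (j + 1) (H.cls n) (cell n)) q).rootStep =
            (Sum.elim (wrapR rnw (H.pgenR rnw j) j) (fun n => PGen.birth (j + 1) (H.cls n) n) q).rootStep := by
        intro q hq
        cases q with
        | inr n => rfl
        | inl p =>
            have hp : p ∈ H.comp j := hW.parts_sub j c hc p ((mem_lefts_iff p _).2 hq)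
            simp only [Sum.elim_inl, rootStep_wrapR]
            cases rnw j p
            · simpa using ih p hp
            · simpa [PGen.rootStep] using ih p hp
      simp only [ComponentHistory.constituentsR, List.mem_map]
      constructor
      · rintro ⟨U, ⟨q, hq, rfl⟩, hUk⟩
        have hq' : q ∈ H.constit (j + 1) c := (hO (j + 1) c hc).mem_iff.1 hq
        exact ⟨_, ⟨q, hq', rfl⟩, by rw [← key q hq']; exact hUk⟩
      · rintro ⟨U, ⟨q, hq, rfl⟩, hUk⟩
        have hq' : q ∈ ord (j + 1) c := (hO (j + 1) c hc).mem_iff.2 hq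
        exact ⟨_, ⟨q, hq', rfl⟩, by rw [key q hq]; exact hUk⟩

/-- the root step of a component's `PGen` does not depend on the chosen admissible order [folklore] -/
theorem rootStep_toPGen_order_free (hW : H.WF) (hO : OrderOK H ord) {ord' : ℕ → γ → List (γ ⊕ γ)}
    (hO' : OrderOK H ord') {j : ℕ} {c : γ} (hc : c ∈ H.comp j) :
    ((pedOf H rnw ord).toPGen cell (j, c)).rootStep = ((pedOf H rnw ord').toPGen cell (j, c)).rootStep := by
  rw [rootStep_toPGen_eq_pgenR cell hW hO j c hc, rootStep_toPGen_eq_pgenR cell hW hO' j c hc]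

end RootStep

/-! ## §3 Oldest line first -/

section Head

variable {γ : Type*} [DecidableEq γ] (H : ComponentHistory γ) (rnw : ℕ → γ → Bool) (ord : ℕ → γ → List (γ ⊕ γ))

/-- **THE DISPLAYED ORDER PROPERTY `HeadOK`**: (`zero`) a component of level `0` has exactly one constituent (no fresh
cluster at level `0`); (`succ`) a component of a successor level with at least two constituents is HEADED BY AN OLD
PART whose extraction root step is minimal among the component's parts (so in particular it HAS an old part — no fresh
cluster at successor levels: located open point G-M4-1).  Constructed from the touch clause in brick 2c. [folklore] -/
structure HeadOK : Prop where
  /-- level-`0` components have one constituent -/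
  zero : ∀ c, c ∈ H.comp 0 → (H.constit 0 c).length ≤ 1
  /-- a component of ≥ 2 constituents is headed by an old part of minimal root step -/
  succ : ∀ j c, c ∈ H.comp (j + 1) → ∀ q₀ q₁ qs, ord (j + 1) c = q₀ :: q₁ :: qs →
    ∃ p₀, q₀ = Sum.inl p₀ ∧ ∀ p ∈ H.parts (j + 1) c, (H.pgenR rnw j p₀).rootStep ≤ (H.pgenR rnw j p).rootStep

variable {H rnw ord}

/-- the root step of the tagged genealogy of a name is print's extraction's (for components; via `rootStep_toPGen`
with cells = labels) [folklore] -/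
theorem rootStep_genT_eq_pgenR [Inhabited γ] (hW : H.WF) (hO : OrderOK H ord) {j : ℕ} {c : γ} (hc : c ∈ H.comp j) :
    ((pedOf H rnw ord).genT (j, c)).rootStep = (H.pgenR rnw j c).rootStep := by
  rw [← Pedigree.rootStep_toPGen (pedOf H rnw ord) id (renew_step_pedOf H rnw ord) (j, c)]
  exact rootStep_toPGen_eq_pgenR id hW hO j c hc

/-- the root step of the tagged genealogy of a component is at most its level [folklore] -/
theorem rootStep_genT_le [Inhabited γ] (hW : H.WF) (hO : OrderOK H ord) {j : ℕ} {c : γ} (hc : c ∈ H.comp j) :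
    ((pedOf H rnw ord).genT (j, c)).rootStep ≤ j := by
  rw [rootStep_genT_eq_pgenR hW hO hc]; exact H.rootStep_pgenR_le rnw j c

/-- **OLDEST LINE FIRST holds for every name of the pedigree** (under `WF`, an admissible order and `HeadOK`).
[folklore] -/
theorem headOldest_pedOf [Inhabited γ] (hW : H.WF) (hO : OrderOK H ord) (hH : HeadOK H rnw ord) :
    ∀ c, (pedOf H rnw ord).HeadOldest c := by
  rintro ⟨j, c⟩ G Gs hG
  unfold Pedigree.partsGen at hG
  rw [parts_pedOf] at hG
  by_cases hc : c ∈ H.comp j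
  swap
  · rw [partsOf_of_not_mem H rnw ord hc, Pedigree.partsGenAux_nil] at hG; exact absurd hG (by simp)
  cases j with
  | zero =>
      -- one constituent: the part list is a singleton, `Gs = []`
      rw [partsOf_zero H rnw ord hc] at hG
      have hlen : (rights (ord 0 c)).length ≤ 1 := by
        have h1 := hH.zero c hc
        have h2 := length_lefts_add_length_rights (ord 0 c)
        rw [(hO 0 c hc).length_eq] at h2
        omega
      have hGs : Gs = [] := by
        have := congrArg List.length hG
        rw [Pedigree.length_partsGenAux, List.length_map, List.length_cons] at this
        exact List.eq_nil_of_length_eq_zero (by omega)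
      subst hGs
      exact ⟨fun _ h => by simp at h, fun h => (h rfl).elim⟩
  | succ j =>
      rw [partsOf_succ H rnw ord hc] at hG
      obtain ⟨q₀, qs, hqs⟩ := List.exists_cons_of_ne_nil (ord_ne_nil hW hO hc)
      cases qs with
      | nil =>
          rw [hqs] at hG
          simp only [List.map_cons, List.map_nil, Pedigree.partsGenAux_cons, Pedigree.partsGenAux_nil,
            List.cons.injEq] at hG
          obtain ⟨-, rfl⟩ := hG
          exact ⟨fun _ h => by simp at h, fun h => (h rfl).elim⟩
      | cons q₁ qs' =>
          obtain ⟨p₀, rfl, hmin⟩ := hH.succ j c hc q₀ q₁ qs' hqs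
          rw [hqs, List.map_cons, Pedigree.partsGenAux_cons, List.cons.injEq] at hG
          obtain ⟨hGe, hGse⟩ := hG
          have hp₀ : p₀ ∈ H.comp j :=
            hW.parts_sub j c hc p₀ (mem_parts_of_inl_mem_ord hO hc (by rw [hqs]; exact List.mem_cons_self))
          -- the head's root step is its old line's extraction root step `≤ j`
          have hGroot : G.rootStep = (H.pgenR rnw j p₀).rootStep := by
            rw [← hGe, toPart_inl, Pedigree.rootStep_partGen]
            exact rootStep_genT_eq_pgenR hW hO hp₀
          have hGle : G.rootStep ≤ j := by rw [hGroot]; exact H.rootStep_pgenR_le rnw j p₀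
          refine ⟨fun K hK => ?_, fun _ => by simp only [step_pedOf]; omega⟩
          rw [← hGse] at hK
          obtain ⟨k, x, hx, rfl⟩ := (pedOf H rnw ord).mem_partsGenAux hK
          obtain ⟨q, hq, rfl⟩ := List.mem_map.1 hx
          cases q with
          | inr n => rw [toPart_inr, Pedigree.rootStep_partGen]; simp only [step_pedOf]; omega
          | inl p =>
              have hpin : Sum.inl p ∈ ord (j + 1) c := by rw [hqs]; exact List.mem_cons_of_mem _ hq
              have hp : p ∈ H.comp j := hW.parts_sub j c hc p (mem_parts_of_inl_mem_ord hO hc hpin)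
              rw [toPart_inl, Pedigree.rootStep_partGen, hGroot]
              show (H.pgenR rnw j p₀).rootStep ≤ ((pedOf H rnw ord).genT (j, p)).rootStep
              rw [rootStep_genT_eq_pgenR hW hO hp]
              exact hmin p (mem_parts_of_inl_mem_ord hO hc hpin)

end Head

end Summit.QuantumFields.BalabanUV.T4Continuum.HistoryGenealogyPedigree
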